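import Literature.RepresentationTheory.Kovacevic2021.SU21RayWeights
import HarnessLib

/-!
# The weights of the invariant Hermitian form on the cone module `D₁ = W(3,0)`

Elementary real-analysis bookkeeping for `Literature.RepresentationTheory.Kovacevic2021.SU21UnitarityCone`,
companion of `SU21RayWeights` (which treats the rays).  On the cone datum `midDS` of `SU21ModulesFromKTypes`
(`K`-types `V_{n,m}`, `n = 3+p+q`, `m = 3p-3q`, arrows `A = -(p+2)(p+3)`, `B = -(q+2)(q+3)`, `C = q/((n-1)n)`,
`D = p/((n-1)n)`) the three recursions of the unitarizability criterion `SU21UnitarityCriterion` read, for weights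
`c(p,q,k)`: `c(p,q,k+1) = k(n-k) c(p,q,k)` (the `𝔨`-condition),
`(n+1-k)(p+2)(p+3) c(p+1,q,k) = ((p+1)/(n(n+1))) c(p,q,k)` (the `A`–`D` edge) and the same with `p ↔ q` (the
`B`–`C` edge) [Kovacevic2021, §4 proof of Thm 4: the weights are fixed `K`-type by `K`-type along the arrows].
We solve them explicitly: `c(p,q,k) = F(p) F(q) G(p+q) β_n(k-1)` with `F(0) = G(0) = 1`,
`F(p+1) = F(p)(p+1)/((p+2)(p+3))`, `G(s+1) = G(s)/((s+3)²(s+4))` and `β_n` the `𝔨`-weights `kBeta` of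
`SU21RayWeights` (`β_{n+1}(j)(n-j) = nβ_n(j)` absorbs the factor `n+1-k`), and prove positivity and the three
recursions (`coneWeight_pos`, `coneWeight_succ_k`, `coneWeight_succ_p`, `coneWeight_succ_q`).
Definitions with bodies; no named facts.

## References

* D. Kovačević, *Unitary `(𝔤,K)` modules of `SU(2,1)`*, Acta Math. Spalatensia 1 (2021) 105–125
  (arXiv:1810.01752): §3 Def 1, Thm 3 (b85), (b100); §4 Thm 4 (proof). [Kovacevic2021]
-/

noncomputable section

namespace Literature.RepresentationTheory.Kovacevic2021

namespace SU21Datum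

/-! ## The weights -/

/-- the factor along one cone direction: `F(0) = 1`, `F(p+1) = F(p) (p+1)/((p+2)(p+3))`
[cite: Kovacevic2021, §4 proof of Thm 4] -/
def coneF : ℕ → ℝ
  | 0 => 1
  | p + 1 => coneF p * (((p : ℝ) + 1) / (((p : ℝ) + 2) * ((p : ℝ) + 3)))

/-- the level factor: `G(0) = 1`, `G(s+1) = G(s)/((s+3)²(s+4))` (`n = s + 3` is the dimension of the `K`-type)
[cite: Kovacevic2021, §4 proof of Thm 4] -/
def coneG : ℕ → ℝ
  | 0 => 1
  | s + 1 => coneG s / ((((s : ℝ) + 3) ^ 2) * ((s : ℝ) + 4))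

/-- the weight of `u^k_{n,m}`, `n = 3+p+q`, `m = 3p-3q`, on the cone `W(3,0)`:
`c(p,q,k) = F(p) F(q) G(p+q) β_{3+p+q}(k-1)` [cite: Kovacevic2021, §4 proof of Thm 4] -/
def coneWeight (p q : ℕ) (k : ℤ) : ℝ :=
  coneF p * coneF q * coneG (p + q) * kBeta ((3 + p + q : ℕ) : ℤ) (k - 1).toNat

/-- `F(p) > 0` [cite: Kovacevic2021, §4 proof of Thm 4] -/
theorem coneF_pos : ∀ p : ℕ, 0 < coneF p
  | 0 => by simp [coneF]
  | p + 1 => by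
    have ih := coneF_pos p
    simp only [coneF]
    positivity

/-- `G(s) > 0` [cite: Kovacevic2021, §4 proof of Thm 4] -/
theorem coneG_pos : ∀ s : ℕ, 0 < coneG s
  | 0 => by simp [coneG]
  | s + 1 => by
    have ih := coneG_pos s
    simp only [coneG]
    positivity

/-- positivity of the cone weights on admissible labels (`1 ≤ k ≤ n = 3+p+q`) [cite: Kovacevic2021, §4 proof of Thm 4] -/
theorem coneWeight_pos (p q : ℕ) {k : ℤ} (hk : 1 ≤ k) (hkn : k ≤ ((3 + p + q : ℕ) : ℤ)) :
    0 < coneWeight p q k :=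
  mul_pos (mul_pos (mul_pos (coneF_pos p) (coneF_pos q)) (coneG_pos _)) (kBeta_pos _ _ (by omega))

/-- the weights are symmetric in `p ↔ q` [cite: Kovacevic2021, §4 proof of Thm 4] -/
theorem coneWeight_comm (p q : ℕ) (k : ℤ) : coneWeight p q k = coneWeight q p k := by
  unfold coneWeight
  rw [Nat.add_comm q p, show 3 + q + p = 3 + p + q by omega, mul_comm (coneF q) (coneF p)]

/-- the `𝔨`-condition: `c(p,q,k+1) = k(n-k) c(p,q,k)`, `n = 3+p+q` [cite: Kovacevic2021, §4 proof of Thm 4] -/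
theorem coneWeight_succ_k (p q : ℕ) {k : ℤ} (hk : 1 ≤ k) :
    coneWeight p q (k + 1) = (k : ℝ) * (((3 + p + q : ℕ) : ℝ) - k) * coneWeight p q k := by
  unfold coneWeight
  have ht : (k + 1 - 1).toNat = (k - 1).toNat + 1 := by omega
  have hj : (((k - 1).toNat : ℕ) : ℝ) = (k : ℝ) - 1 := by
    have h1 : (((k - 1).toNat : ℕ) : ℤ) = k - 1 := Int.toNat_of_nonneg (by omega)
    exact_mod_cast h1
  rw [ht, kBeta, hj]
  push_cast
  ring

/-- the `A`–`D` edge condition: `(n+1-k)(p+2)(p+3) c(p+1,q,k) = ((p+1)/(n(n+1))) c(p,q,k)`, `n = 3+p+q`, i.e.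
`(n+1-k) A_{n,m} c(n+1,m+3,k) = -D_{n+1,m+3} c(n,m,k)` on the cone [cite: Kovacevic2021, §4 proof of Thm 4] -/
theorem coneWeight_succ_p (p q : ℕ) {k : ℤ} (hk : 1 ≤ k) (hkn : k ≤ ((3 + p + q : ℕ) : ℤ)) :
    (((3 + p + q : ℕ) : ℝ) + 1 - k) * (((p : ℝ) + 2) * ((p : ℝ) + 3)) * coneWeight (p + 1) q k
      = ((p : ℝ) + 1) / (((3 + p + q : ℕ) : ℝ) * (((3 + p + q : ℕ) : ℝ) + 1)) * coneWeight p q k := by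
  unfold coneWeight
  -- the level of `(p+1, q)` is `n + 1`
  have hN : (((3 + (p + 1) + q : ℕ) : ℤ)) = ((3 + p + q : ℕ) : ℤ) + 1 := by push_cast; ring
  have hs : p + 1 + q = (p + q) + 1 := by omega
  set N : ℤ := ((3 + p + q : ℕ) : ℤ) with hNdef
  have hNR : ((3 + p + q : ℕ) : ℝ) = (N : ℝ) := by rw [hNdef]; push_cast; ring
  have hj : (((k - 1).toNat : ℕ) : ℝ) = (k : ℝ) - 1 := by
    have h1 : (((k - 1).toNat : ℕ) : ℤ) = k - 1 := Int.toNat_of_nonneg (by omega)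
    exact_mod_cast h1
  have T := kBeta_succ_mul N (k - 1).toNat
  rw [hj] at T
  -- `β_{N+1}(k-1) (N + 1 - k) = N β_N(k-1)`
  have hN1 : (1 : ℝ) ≤ N := by
    have : (3 : ℤ) ≤ N := by rw [hNdef]; push_cast; omega
    have : (3 : ℝ) ≤ N := by exact_mod_cast this
    linarith
  have hNk : (N : ℝ) + 1 - k ≠ 0 := by
    have : (k : ℝ) ≤ N := by exact_mod_cast hkn
    linarith
  have hN0 : (N : ℝ) ≠ 0 := by linarith
  have hN1' : (N : ℝ) + 1 ≠ 0 := by linarith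
  have hp2 : (p : ℝ) + 2 ≠ 0 := by positivity
  have hp3 : (p : ℝ) + 3 ≠ 0 := by positivity
  have hN3 : (N : ℝ) = (p : ℝ) + q + 3 := by rw [hNdef]; push_cast; ring
  have T' : kBeta (N + 1) (k - 1).toNat = N * kBeta N (k - 1).toNat / ((N : ℝ) + 1 - k) := by
    rw [eq_div_iff hNk, show (N : ℝ) + 1 - k = N - (k - 1) by ring]
    exact T
  rw [hN, hs, coneF, coneG, T', hNR]
  field_simp
  rw [hN3]
  push_cast
  ring

/-- the `B`–`C` edge condition: `(n+1-k)(q+2)(q+3) c(p,q+1,k) = ((q+1)/(n(n+1))) c(p,q,k)`, `n = 3+p+q`, i.e.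
`conj(C_{n,m}) c(n-1,m+3,k) = -(n-k) B_{n-1,m+3} c(n,m,k)` on the cone (read at `(p,q+1)`)
[cite: Kovacevic2021, §4 proof of Thm 4] -/
theorem coneWeight_succ_q (p q : ℕ) {k : ℤ} (hk : 1 ≤ k) (hkn : k ≤ ((3 + p + q : ℕ) : ℤ)) :
    (((3 + p + q : ℕ) : ℝ) + 1 - k) * (((q : ℝ) + 2) * ((q : ℝ) + 3)) * coneWeight p (q + 1) k
      = ((q : ℝ) + 1) / (((3 + p + q : ℕ) : ℝ) * (((3 + p + q : ℕ) : ℝ) + 1)) * coneWeight p q k := by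
  rw [coneWeight_comm p (q + 1), coneWeight_comm p q, show 3 + p + q = 3 + q + p by omega]
  exact coneWeight_succ_p q p hk (by omega)

end SU21Datum

end Literature.RepresentationTheory.Kovacevic2021
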